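import Summits.BirchSwinnertonDyer.BirchSwinnertonDyer.Theorems.PrintCf2DisegniPairTwoFramePair
import Summits.BirchSwinnertonDyer.BirchSwinnertonDyer.Theorems.InertBadSignedBranchesInertBadAtThreeQuarticModel
import Literature.NumberTheory.EllipticCurves.PadicSigmaSqMinusTwistModelTransportProofs
import Literature.NumberTheory.EllipticCurves.CuspFormLFunctionLevelConductorProofs
import Literature.NumberTheory.EllipticCurves.LFunctionPrimeCoeff
import Literature.NumberTheory.EllipticCurves.LeadingTermBSZOrdinaryProofs
import Literature.NumberTheory.EllipticCurves.PAdicLFunctionMinus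
import HarnessLib

/-!
# Road (C) `disegni-pair-two` on crux stmt-BirchSwinnertonDyer-20368 — RIGIDITY of the left-hand side of the
# (Δ1) descent law — the bricks: unit root, newform, periods, generator and the model-free height

Cell `bsd-print-cf2`, width seat `bsd-line-cf2-p1-w8` (g30), `--supports stmt-BirchSwinnertonDyer-20368` (helper; LEAD g25's
«TIGHTNESS» §5(iv)). THEOREMS ONLY (no `def`, no named fact introduced, no `sorry`); no `Theses` import (outside the route cone).

The registered research stub (Δ1) `stub_law_descent_two` of `Cruxes/SplitBadTwoRankOneOfFacts/Lines/disegni_pair_two.lean`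
(v3.5–v3.10) asserts, class by class, the `2`-adic valuation identity
`v(D(f, α_V)) + v₂(ϖ|μ) − v(Dc.pairing P P) = v₂(#Ш(W)[2^∞]) + v₂(Tam W) − 2v₂(#W(ℚ)_tors) + e_D(class)` for EVERY choice of:
a globally minimal model `V` of the good partner `49a1^{(d′)}`, a newform `f` of `V` at any level, the period ratio `ϖ`/`μ`, a
generator `P` of `V^{(d*)}(ℚ)` modulo torsion, and a datum `Dc` with `IsCanonicalSqMinusTwist`. The law socket
(`defectKey_sevenFree_of_lawDescent_two`) consumes it only at the FRAME's data. This file proves that the left-hand side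
does not depend on any of these choices:

* §1 two globally minimal models of `49a1^{(d′)}` differ by `D = (±1, r, s, t)`, `r, s, t ∈ ℤ` (`isGloballyMinimal_unique_holds`),
  and have `a₁` odd (`norm_a₁_two_eq_one_of_smul_eq_cm7_quadraticTwist`);
* §2 (R1) the unit root `α_V = unitRoot V 2` is model-free (`a₂ = LFunction 2` is, `LFunction_smul`);
* §3 (R2) the newform binder is literally pinned: `IsNewformOf V f`, `IsNewformOf V f′` force level and form to coincide
  (`IsNewformOf.level_eq_level` — strong multiplicity one, unconditional in the tree — and `IsNewformOf.unique`), and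
  `IsNewformOf` is model-free; so `padicLFunction f α`, `padicLFunctionMinusBranch f α 1`, `plusPeriod f`, `minusPeriod f`
  are pinned;
* §4 (R3) `realPeriodRat`, `imaginaryPeriodRat` are model-free (`u = ±1`), hence so is `ϖ`/`μ`;
* §5 (R5) `Dc.pairing P P` does not depend on the generator `P` (bilinear, torsion-vanishing: `P′ = ±P + T`);
* §6 (R4, on the Literature bricks `PadicSigmaSqInvXVariableChangeProofs` / `PadicSigmaSqMinusTwistModelTransportProofs` of this
  seat) ★ `pairing_generator_rigid`: `Dc.pairing P P` depends neither on the globally minimal model `V`, nor on the canonical datum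
  `Dc`, nor on the generator `P` (`d ∈ {−1, 2, −2}`).
The sequel `PrintCf2DisegniPairTwoLawRigidityClasses.lean` assembles the three CLASS RIGIDITY theorems and derives (Δ1) VERBATIM from
its existential form «one datum per member».

READING: 20368 = 12 primary prints + (Δ1) is UNCHANGED; this file neither proves (Δ1) nor the crux; BSD is not proved by any
of this. It certifies that (Δ1)'s universal binders carry no strength beyond one datum per member.

References: B. Mazur, W. Stein, J. Tate (2006) §1; B. Mazur, J. Tate (1991) §3; J. H. Silverman, AEC VII.1.3(b), VIII.8.3;
A. Atkin, J. Lehner (1970) Thm. 4; B. Mazur, J. Tate, J. Teitelbaum (1986) §I.10–I.14.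
-/

set_option autoImplicit false
set_option linter.dupNamespace false

noncomputable section

open scoped Classical MatrixGroups ModularForm NumberField

open CongruenceSubgroup WeierstrassCurve Literature.NumberTheory.EllipticCurves
  Literature.NumberTheory.EllipticCurves.ModularForms
  Summit.BirchSwinnertonDyer.BirchSwinnertonDyer.Theorems.InertBadSignedBranchesInertBadAtThreeQuarticModel

namespace Summit.BirchSwinnertonDyer.BirchSwinnertonDyer.Theorems.PrintCf2.DisegniPairTwo

/-! ### §1 Two globally minimal models of the partner -/

/-- **Two globally minimal models of the same curve differ by an INTEGRAL isomorphism**: if `C₁ • V = X = C₁′ • V′` with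
`V, V′` globally minimal elliptic, then `D • V = V′` for `D = C₁′⁻¹C₁` with `u = ±1`, `r, s, t ∈ ℤ`.
[cite: SilvermanAEC2009, VII.1.3(b) and VIII.8.3] -/
theorem exists_integral_smul_eq_of_models {X : WeierstrassCurve ℚ} (V V' : WeierstrassCurve ℚ) [V.IsElliptic]
    [V.IsGloballyMinimal] [V'.IsElliptic] [V'.IsGloballyMinimal] (C₁ C₁' : VariableChange ℚ) (hC₁ : C₁ • V = X)
    (hC₁' : C₁' • V' = X) :
    ∃ D : VariableChange ℚ, D • V = V' ∧ (D.u = 1 ∨ D.u = -1) ∧ ∃ r s t : ℤ, D.r = r ∧ D.s = s ∧ D.t = t := by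
  refine ⟨C₁'⁻¹ * C₁, by rw [mul_smul, hC₁, ← hC₁', inv_smul_smul], ?_⟩
  have hD : (C₁'⁻¹ * C₁) • V = V' := by rw [mul_smul, hC₁, ← hC₁', inv_smul_smul]
  haveI : ((C₁'⁻¹ * C₁) • V).IsGloballyMinimal := by rw [hD]; infer_instance
  exact isGloballyMinimal_unique_holds V (C₁'⁻¹ * C₁)

/-- **Every globally minimal model `V` of `49a1^{(d′)}` (`d′ ≡ 1 (mod 4)` squarefree) has `a₁` ODD, i.e. `‖a₁‖₂ = 1`**: the integral
model `W_k = [1, −(3k+1), 0, −2d′², −d′³]` is globally minimal, `D • V = W_k` with `u = ±1`, `s ∈ ℤ`, and `1 = a₁(W_k) = u⁻¹(a₁(V) + 2s)`.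
(So `log_{V ⊗ ℚ₂}` has unbounded denominators, `unbounded_formalLog_two_of_norm_a₁_eq_one`: the uniqueness input of the `σ²`
transport.) [cite: SilvermanAEC2009, VII.1.3(b) and III.1 Table 3.1] -/
theorem norm_a₁_two_eq_one_of_smul_eq_cm7_quadraticTwist {d' : ℤ} (hd4 : d' % 4 = 1) (hsq : Squarefree d')
    (V : WeierstrassCurve ℚ) [V.IsElliptic] [V.IsGloballyMinimal] (C₁ : VariableChange ℚ)
    (hC₁ : C₁ • V = cm7.quadraticTwist (d' : ℚ)) : ‖(V.baseChange ℚ_[2]).a₁‖ = 1 := by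
  obtain ⟨k, rfl⟩ : ∃ k : ℤ, d' = 4 * k + 1 := ⟨d' / 4, by omega⟩
  set Wk : WeierstrassCurve ℚ :=
    ⟨1, -(3 * (k : ℚ) + 1), 0, -2 * (4 * (k : ℚ) + 1) ^ 2, -(4 * (k : ℚ) + 1) ^ 3⟩ with hWk
  set A : VariableChange ℚ := ⟨1, 0, 1 / 2, 0⟩ with hA
  have hAV : A • cm7.quadraticTwist (((4 * k + 1 : ℤ)) : ℚ) = Wk := by
    rw [hA, cm7_quadraticTwist_smul_eq k]
    ext <;> simp [WeierstrassCurve.map, hWk]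
  haveI : Wk.IsElliptic := cm7Twist_isElliptic Wk k hWk
  haveI hWkmin : Wk.IsGloballyMinimal := cm7Twist_isGloballyMinimal_of_squarefree Wk k hWk hsq
  set D : VariableChange ℚ := A * C₁ with hD
  have hDV : D • V = Wk := by rw [hD, mul_smul, hC₁, hAV]
  haveI : (D • V).IsGloballyMinimal := by rw [hDV]; exact hWkmin
  obtain ⟨hu, r, s, t, -, hs, -⟩ := isGloballyMinimal_unique_holds V D
  have ha1 : (D • V).a₁ = 1 := by rw [hDV]
  rw [variableChange_a₁, hs] at ha1
  -- `a₁(V) = u − 2s`, an odd integer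
  have hVa : V.a₁ = ((D.u : ℚ)) - 2 * s := by
    have hu1 : ((D.u⁻¹ : ℚˣ) : ℚ) * (D.u : ℚ) = 1 := by simp
    rcases hu with h | h
    · rw [h] at ha1; simp at ha1; rw [h]; push_cast; linarith
    · rw [h] at ha1; simp at ha1; rw [h]; push_cast; linarith
  obtain ⟨m, hm, hmodd⟩ : ∃ m : ℤ, V.a₁ = m ∧ ¬ (2 : ℤ) ∣ m := by
    rcases hu with h | h
    · exact ⟨1 - 2 * s, by rw [hVa, h]; push_cast; ring, by omega⟩
    · exact ⟨-1 - 2 * s, by rw [hVa, h]; push_cast; ring, by omega⟩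
  have hcast : (V.baseChange ℚ_[2]).a₁ = ((m : ℤ) : ℚ_[2]) := by
    show algebraMap ℚ ℚ_[2] V.a₁ = _; rw [hm]; simp
  rw [hcast]
  refine le_antisymm (Padic.norm_int_le_one m) (not_lt.mp fun hlt => hmodd ?_)
  exact_mod_cast (Padic.norm_intCast_lt_one_iff.mp hlt)

/-! ### §2 (R1) The unit root is model-free -/

/-- **`unitRoot V 2 = unitRoot V′ 2` for two globally minimal models `D • V = V′` good at `2`**: the unit root depends on `V` only
through `a₂(V) = frobeniusTrace V 2 = LFunction V 2` (good reduction), and Mathlib's `LFunction` is an isomorphism invariant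
(`LFunction_smul`). [cite: MazurTateTeitelbaum1986Invent, §I.11 (allowable root)] [cite: SilvermanAEC2009, App. C §16 with VII.1.3(b)] -/
theorem unitRoot_two_eq_of_smul_eq (V V' : WeierstrassCurve ℚ) [V.IsElliptic] [V.IsGloballyMinimal] [V'.IsElliptic]
    [V'.IsGloballyMinimal] {D : VariableChange ℚ} (hD : D • V = V') (hgood : V.HasGoodReductionAtPrime 2) :
    unitRoot V 2 = unitRoot V' 2 := by
  have hgood' : V'.HasGoodReductionAtPrime 2 := by
    rw [← hD]; exact (BSZLemma17.hasGoodReductionAtPrime_smul_iff V D 2).mpr hgood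
  have h : V.frobeniusTrace 2 = V'.frobeniusTrace 2 := by
    rw [← LFunction_apply_prime_eq_frobeniusTrace V 2 hgood, ← LFunction_apply_prime_eq_frobeniusTrace V' 2 hgood', ← hD,
      LFunction_smul]
  simp only [unitRoot, h]

/-! ### §3 (R2) The newform binder is pinned -/

/-- **`IsNewformOf` is model-free**: `IsNewformOf (D • V) f ↔ IsNewformOf V f` (`aₙ(f) = LFunction n`, `LFunction_smul`).
[cite: BreuilConradDiamondTaylor2001, Thm. A] [cite: SilvermanAEC2009, App. C §16 with VII.1.3(b)] -/
theorem isNewformOf_iff_of_smul_eq {V V' : WeierstrassCurve ℚ} [V.IsElliptic] {D : VariableChange ℚ} (hD : D • V = V')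
    {N : ℕ} [NeZero N] (f : CuspForm (Gamma0 N) 2) : IsNewformOf V' f ↔ IsNewformOf V f := by
  rw [IsNewformOf, IsNewformOf, ← hD, LFunction_smul]

/-- **Two newforms of one curve coincide, at any two levels** — so every quantity read off «a newform `f` of `V`» is pinned:
`padicLFunction`, `padicLFunctionMinusBranch`, `plusPeriod`, `minusPeriod`. Strong multiplicity one across levels
(`IsNewformOf.level_eq_level`, Atkin–Lehner Thm. 4, unconditional in the tree) + the `q`-expansion principle (`IsNewformOf.unique`).
[cite: AtkinLehner1970, Thm. 4] -/
theorem newform_quantities_eq_of_isNewformOf {V : WeierstrassCurve ℚ} [V.IsElliptic] {N N' : ℕ} [NeZero N] [NeZero N']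
    {f : CuspForm (Gamma0 N) 2} {f' : CuspForm (Gamma0 N') 2} (hf : IsNewformOf V f) (hf' : IsNewformOf V f')
    (α : ℚ_[2]) :
    padicLFunction f α = padicLFunction f' α ∧ padicLFunctionMinusBranch f α 1 = padicLFunctionMinusBranch f' α 1 ∧
      plusPeriod f = plusPeriod f' ∧ minusPeriod f = minusPeriod f' := by
  obtain rfl := hf.level_eq_level hf'
  obtain rfl := hf.unique hf'
  exact ⟨rfl, rfl, rfl, rfl⟩

/-! ### §4 (R3) The periods are model-free -/

/-- **`Ω(V′) = Ω(V)` and `Ω⁻(V′) = Ω⁻(V)` for `D • V = V′` with `u = ±1`** (`Ω(C • W) = |u|Ω(W)`, `Ω⁻(C • W) = |u|Ω⁻(W)`).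
[cite: SilvermanAEC2009, III.1 Table 3.1 and VIII.8.3] -/
theorem periods_eq_of_smul_eq {V V' : WeierstrassCurve ℚ} [V.IsElliptic] {D : VariableChange ℚ} (hD : D • V = V')
    (hu : D.u = 1 ∨ D.u = -1) : V'.realPeriodRat = V.realPeriodRat ∧ V'.imaginaryPeriodRat = V.imaginaryPeriodRat := by
  subst hD
  rw [realPeriodRat_smul_holds V D, imaginaryPeriodRat_smul V D]
  rcases hu with h | h <;> simp [h]

/-- The period ratio is pinned: `ϖ·Ω = Ω⁺ = ϖ′·Ω` with `Ω > 0` forces `ϖ = ϖ′` (and likewise for `μ` against `Ω⁻ ≠ 0` when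
`Ω⁻ ≠ 0`; we only need the real-period case and the imaginary one with the SAME `Ω⁻`). [cite: SilvermanAEC2009, App. C §16] -/
theorem ratio_eq_of_mul_eq {Ω : ℝ} (hΩ : Ω ≠ 0) {a b : ℚ} {c : ℝ} (ha : (a : ℝ) * Ω = c) (hb : (b : ℝ) * Ω = c) : a = b := by
  have : (a : ℝ) = b := mul_right_cancel₀ hΩ (ha.trans hb.symm)
  exact_mod_cast this

/-! ### §5 (R5) The height of a generator is generator-free -/

/-- **`Dc.pairing P P = Dc.pairing P′ P′` for two generators modulo torsion** of the same group: `P′ = kP + T`, `P = k′P′ + T′`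
with `T, T′` torsion give `⟨P′,P′⟩ = k²⟨P,P⟩` and `⟨P,P⟩ = k′²⟨P′,P′⟩` (bilinear, torsion-vanishing), whence `k²k′² = 1` or
`⟨P,P⟩ = 0`; either way the two heights agree. [cite: MazurTateTeitelbaum1986Invent, §II.4] -/
theorem pairing_self_eq_of_generators {X : WeierstrassCurve ℚ} (Dc : PAdicHeightData X 2) (P P' : X.toAffine.Point)
    (hgen : ∀ R : X.toAffine.Point, ∃ (k : ℤ) (T : X.toAffine.Point), IsOfFinAddOrder T ∧ R = k • P + T)
    (hgen' : ∀ R : X.toAffine.Point, ∃ (k : ℤ) (T : X.toAffine.Point), IsOfFinAddOrder T ∧ R = k • P' + T) :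
    Dc.pairing P P = Dc.pairing P' P' := by
  -- `⟨kQ + T, kQ + T⟩ = k²⟨Q,Q⟩`
  have key : ∀ (Q T : X.toAffine.Point) (k : ℤ), IsOfFinAddOrder T →
      Dc.pairing (k • Q + T) (k • Q + T) = ((k : ℚ_[2]) * k) * Dc.pairing Q Q := by
    intro Q T k hT
    have h1 : ∀ R, Dc.pairing T R = 0 := fun R => Dc.map_torsion T R hT
    have h2 : ∀ R, Dc.pairing R T = 0 := fun R => Dc.map_torsion_right R T hT
    simp only [map_add, map_zsmul, AddMonoidHom.add_apply, AddMonoidHom.zsmul_apply, h1, h2, smul_zero, add_zero,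
      zsmul_eq_mul, mul_assoc]
  obtain ⟨k, T, hT, hP'⟩ := hgen P'
  obtain ⟨k', T', hT', hP⟩ := hgen' P
  have h1 : Dc.pairing P' P' = ((k : ℚ_[2]) * k) * Dc.pairing P P := by rw [hP']; exact key P T k hT
  have h2 : Dc.pairing P P = ((k' : ℚ_[2]) * k') * Dc.pairing P' P' := by
    conv_lhs => rw [hP]
    exact key P' T' k' hT'
  by_cases h0 : Dc.pairing P P = 0
  · rw [h1, h0, mul_zero]
  · have h3 : Dc.pairing P P = ((k' : ℚ_[2]) * k') * ((k : ℚ_[2]) * k) * Dc.pairing P P := by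
      rw [mul_assoc, ← h1]; exact h2
    have h4 : ((k' : ℚ_[2]) * k') * ((k : ℚ_[2]) * k) = 1 := by
      have := mul_right_cancel₀ h0 (h3.symm.trans (one_mul _).symm)
      exact this
    have h5 : ((k' * k) * (k' * k) : ℤ) = 1 := by
      have : (((k' * k) * (k' * k) : ℤ) : ℚ_[2]) = 1 := by push_cast; linear_combination h4
      exact_mod_cast this
    have h6 : k * k = 1 := by
      rcases Int.eq_one_or_neg_one_of_mul_eq_one' h5 with ⟨h, -⟩ | ⟨h, -⟩
      · rcases Int.eq_one_or_neg_one_of_mul_eq_one' h with ⟨-, hk⟩ | ⟨-, hk⟩ <;> simp [hk]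
      · rcases Int.eq_one_or_neg_one_of_mul_eq_neg_one' h with ⟨-, hk⟩ | ⟨-, hk⟩ <;> simp [hk]
    rw [h1, ← Int.cast_mul, h6, Int.cast_one, one_mul]

/-- A generator modulo torsion is carried to a generator modulo torsion by an additive isomorphism. [folklore] -/
theorem generator_map {X Y : WeierstrassCurve ℚ} (φ : X.toAffine.Point ≃+ Y.toAffine.Point) {P : X.toAffine.Point}
    (hgen : ∀ R : X.toAffine.Point, ∃ (k : ℤ) (T : X.toAffine.Point), IsOfFinAddOrder T ∧ R = k • P + T) :
    ∀ R : Y.toAffine.Point, ∃ (k : ℤ) (T : Y.toAffine.Point), IsOfFinAddOrder T ∧ R = k • φ P + T := by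
  intro R
  obtain ⟨k, T, hT, hR⟩ := hgen (φ.symm R)
  refine ⟨k, φ T, φ.toAddMonoidHom.isOfFinAddOrder hT, ?_⟩
  rw [← map_zsmul, ← map_add, ← hR, AddEquiv.apply_symm_apply]

/-! ### §6 (R4) The height of a generator is model-free and datum-free -/

/-- **The canonical minus-twist height of a generator is MODEL-FREE and DATUM-FREE** (`d ∈ {−1, 2, −2}`): for two globally minimal
models `V, V′` of `49a1^{(d′)}`, generators `P`, `P′` of `V^{(d)}(ℚ)`, `V′^{(d)}(ℚ)` modulo torsion and canonical data `Dc`, `Dc′`,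
`Dc.pairing P P = Dc′.pairing P′ P′`: the models differ by an integral `D` (§1), the twist models by `D^{(d)} = (u, d r, 0, 0)`, the induced
isomorphism carries `P` to a generator and canonical data agree along it (`IsCanonicalSqMinusTwist.pairing_map_map_eq`: `a₁` odd
gives unbounded `log`, `exists_isMazurTateSigmaSqPair_two_of_smul_eq_cm7_quadraticTwist` the pair on `V′ ⊗ ℚ₂`), then §5.
[cite: MazurSteinTate2006, §1] [cite: SilvermanAEC2009, VII.1.3(b)] -/
theorem pairing_generator_rigid {d' : ℤ} (hd4 : d' % 4 = 1) (hsq : Squarefree d') {d : ℤ} (hd : d = -1 ∨ d = 2 ∨ d = -2)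
    (V : WeierstrassCurve ℚ) [V.IsElliptic] [V.IsGloballyMinimal] (C₁ : VariableChange ℚ)
    (hC₁ : C₁ • V = cm7.quadraticTwist (d' : ℚ))
    (P : (V.quadraticTwist (d : ℚ)).toAffine.Point)
    (hgen : ∀ R : (V.quadraticTwist (d : ℚ)).toAffine.Point,
      ∃ (k : ℤ) (T : (V.quadraticTwist (d : ℚ)).toAffine.Point), IsOfFinAddOrder T ∧ R = k • P + T)
    (Dc : PAdicHeightData (V.quadraticTwist (d : ℚ)) 2) (hDc : Dc.IsCanonicalSqMinusTwist)
    (V' : WeierstrassCurve ℚ) [V'.IsElliptic] [V'.IsGloballyMinimal] (C₁' : VariableChange ℚ)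
    (hC₁' : C₁' • V' = cm7.quadraticTwist (d' : ℚ))
    (P' : (V'.quadraticTwist (d : ℚ)).toAffine.Point)
    (hgen' : ∀ R : (V'.quadraticTwist (d : ℚ)).toAffine.Point,
      ∃ (k : ℤ) (T : (V'.quadraticTwist (d : ℚ)).toAffine.Point), IsOfFinAddOrder T ∧ R = k • P' + T)
    (Dc' : PAdicHeightData (V'.quadraticTwist (d : ℚ)) 2) (hDc' : Dc'.IsCanonicalSqMinusTwist) :
    Dc.pairing P P = Dc'.pairing P' P' := by
  obtain ⟨D, hD, hu, r, s, t, hr, hs, ht⟩ := exists_integral_smul_eq_of_models V V' C₁ C₁' hC₁ hC₁'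
  have ha := norm_a₁_two_eq_one_of_smul_eq_cm7_quadraticTwist hd4 hsq V C₁ hC₁
  have hlog := (V.baseChange ℚ_[2]).unbounded_formalLog_two_of_norm_a₁_eq_one ha
  have hlog' : ∀ N : ℕ, ∃ m, (2 : ℝ) ^ N < ‖PowerSeries.coeff m (V.baseChange ℚ_[2]).formalLog‖ := by
    simpa using hlog
  have hex := exists_isMazurTateSigmaSqPair_two_of_smul_eq_cm7_quadraticTwist hd4 hsq V' C₁' hC₁'
  have hDd := twistedChange_smul_quadraticTwist_eq (V := V) (V₂ := V') (D := D) (d : ℚ) hD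
  set φ := (VariableChange.pointEquiv (V.quadraticTwist (d : ℚ)) ⟨D.u, (d : ℚ) * D.r, 0, 0⟩).trans
    (Affine.Point.congrEquiv hDd) with hφ
  have hφsome : ∀ {x y : ℚ} (h : (V.quadraticTwist (d : ℚ)).toAffine.Nonsingular x y),
      ∃ (x₂ y₂ : ℚ) (h₂ : (V'.quadraticTwist (d : ℚ)).toAffine.Nonsingular x₂ y₂),
        φ (.some x y h) = .some x₂ y₂ h₂ ∧ x₂ = x - (d : ℚ) * D.r :=
    fun h => minusTwist_pointEquiv_some (d : ℚ) hu hDd h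
  have hmap := PAdicHeightData.IsCanonicalSqMinusTwist.pairing_map_map_eq hD hu hr hs ht hlog' hex hd φ hφsome hDc hDc' P P
  rw [← hmap]
  exact pairing_self_eq_of_generators Dc' (φ P) P' (generator_map φ hgen) hgen'

end Summit.BirchSwinnertonDyer.BirchSwinnertonDyer.Theorems.PrintCf2.DisegniPairTwo

end
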